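import Literature.Analysis.Complex.PickFunctions
import Literature.Analysis.Complex.PickFunctionsProofsDisc
import HarnessLib

/-!
# Nevanlinna's representation of Pick functions: existence, via the Cayley transform

Second support file for the discharge of the named fact
`Literature.Analysis.Complex.nevanlinna_representation` (Rosenblum–Rovnyak 1985, Appendix §6,
Theorem B). From the Herglotz–Riesz theorem on the unit disc
(`Literature.Analysis.Complex.exists_measure_herglotz_riesz`, sibling file
`PickFunctionsProofsDisc`) we derive the existence half of Theorem B:

* algebra of the Cayley transform `C(w) = i(1 + w)/(1 - w)` (disc → upper half-plane) and its
  inverse `D(z) = (z - i)/(z + i)`: `C ∘ D = id` on `Π`, `D ∘ C = id` off `1`, `C` is real on the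
  unit circle, `|D z| < 1` on `Π`, `Im C(w) > 0` on the disc, and the kernel identity
  `i (D t + D z)/(D t - D z) = (1 + tz)/(t - z) = (1 + t²)(1/(t - z) - t/(1 + t²))`;
* `IsPickFunction.exists_nevanlinna_repr`: a Pick function `f` is
  `f(z) = b + cz + π⁻¹ ∫ (1/(t - z) - t/(1 + t²)) dμ(t)` with `b = Re f(i)`, `c = ν({1}) ≥ 0` and
  `μ = π (1 + t²) · C_*(ν|_{ζ ≠ 1})`, where `ν` is the Herglotz measure of `G = -i f ∘ C`.

All expressions are written out (no new definitions); the lemmas are folklore, the theorem is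
cited to Rosenblum–Rovnyak.
-/

noncomputable section

open MeasureTheory Metric Set Filter Real
open _root_.Complex
open scoped Topology ComplexConjugate NNReal ENNReal

namespace Literature.Analysis.Complex

/-! ### Algebra of the Cayley transform `w ↦ i(1+w)/(1-w)` and its inverse `z ↦ (z-i)/(z+i)` -/

/-- `z + i ≠ 0` for `z` in the closed upper half-plane. [folklore] -/
theorem add_I_ne_zero_of_im_nonneg {z : ℂ} (hz : 0 ≤ z.im) : z + I ≠ 0 := by
  intro h
  have := congrArg Complex.im h
  simp at this
  linarith

/-- The inverse Cayley transform maps the upper half-plane into the unit disc: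
`|(z - i)/(z + i)| < 1` for `Im z > 0`. [folklore] -/
theorem norm_cayleyInv_lt_one {z : ℂ} (hz : 0 < z.im) : ‖(z - I) / (z + I)‖ < 1 := by
  have hne : z + I ≠ 0 := add_I_ne_zero_of_im_nonneg hz.le
  rw [norm_div, div_lt_one (norm_pos_iff.2 hne), ← sq_lt_sq₀ (norm_nonneg _) (norm_nonneg _),
    Complex.sq_norm, Complex.sq_norm, Complex.normSq_apply, Complex.normSq_apply]
  simp
  nlinarith

/-- `C(D(z)) = z`: the Cayley transform inverts `z ↦ (z - i)/(z + i)` (`z ≠ -i`). [folklore] -/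
theorem cayley_cayleyInv {z : ℂ} (hz : z + I ≠ 0) :
    I * (1 + (z - I) / (z + I)) / (1 - (z - I) / (z + I)) = z := by
  have h2 : (1 - (z - I) / (z + I)) = 2 * I / (z + I) := by
    field_simp
    ring
  have h1 : (1 + (z - I) / (z + I)) = 2 * z / (z + I) := by
    field_simp
    ring
  rw [h1, h2]
  field_simp

/-- The Cayley transform is real on the unit circle. [folklore] -/
theorem cayley_im_eq_zero {ζ : ℂ} (hζ : ‖ζ‖ = 1) : (I * (1 + ζ) / (1 - ζ)).im = 0 := by
  have h : ζ.re * ζ.re + ζ.im * ζ.im = 1 := by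
    have := Complex.sq_norm ζ
    rw [hζ, Complex.normSq_apply] at this
    linarith
  rw [Complex.div_im]
  simp
  rw [← sub_div, div_eq_zero_iff]
  left
  nlinarith

/-- `D(C(ζ)) = ζ` for `ζ ≠ 1`. [folklore] -/
theorem cayleyInv_cayley {ζ : ℂ} (hζ : ζ ≠ 1) :
    (I * (1 + ζ) / (1 - ζ) - I) / (I * (1 + ζ) / (1 - ζ) + I) = ζ := by
  have h1 : (1 - ζ) ≠ 0 := sub_ne_zero.2 (Ne.symm hζ)
  have hn : I * (1 + ζ) / (1 - ζ) - I = 2 * I * ζ / (1 - ζ) := by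
    field_simp; ring
  have hd : I * (1 + ζ) / (1 - ζ) + I = 2 * I / (1 - ζ) := by
    field_simp; ring
  rw [hn, hd]
  field_simp

/-- The Cayley transform maps the unit disc into the upper half-plane. [folklore] -/
theorem im_cayley_pos {w : ℂ} (hw : ‖w‖ < 1) : 0 < (I * (1 + w) / (1 - w)).im := by
  have h1 : (1 - w) ≠ 0 := by
    intro h
    have : w = 1 := by linear_combination -h
    rw [this] at hw; simp at hw
  rw [Complex.div_im]
  have hns : 0 < Complex.normSq (1 - w) := Complex.normSq_pos.2 h1
  have hw2 : w.re * w.re + w.im * w.im < 1 := by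
    have := Complex.sq_norm w
    rw [Complex.normSq_apply] at this
    nlinarith [norm_nonneg w]
  simp
  rw [div_lt_div_iff_of_pos_right hns]
  nlinarith

/-- The Herglotz kernel transported by the Cayley transform:
`i (D t + D z)/(D t - D z) = (1 + tz)/(t - z)` for real `t ≠ z`, `D u = (u - i)/(u + i)`.
[folklore] -/
theorem I_mul_herglotz_kernel_cayleyInv {t : ℝ} {z : ℂ} (hz : z + I ≠ 0) (htz : (t : ℂ) ≠ z) :
    I * ((((t : ℂ) - I) / (t + I) + (z - I) / (z + I)) /
      (((t : ℂ) - I) / (t + I) - (z - I) / (z + I))) = (1 + t * z) / (t - z) := by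
  have ht : (t : ℂ) + I ≠ 0 := add_I_ne_zero_of_im_nonneg (by simp)
  have htz' : (t : ℂ) - z ≠ 0 := sub_ne_zero.2 htz
  have hnum : ((t : ℂ) - I) / (t + I) + (z - I) / (z + I) =
      2 * (1 + t * z) / ((t + I) * (z + I)) := by
    field_simp
    ring_nf
    simp [Complex.I_sq]
    ring
  have hden : ((t : ℂ) - I) / (t + I) - (z - I) / (z + I) =
      2 * I * (t - z) / ((t + I) * (z + I)) := by
    field_simp
    ring
  rw [hnum, hden]
  field_simp

/-- `(1 + tz)/(t - z) = (1 + t²)(1/(t - z) - t/(1 + t²))` for real `t ≠ z`. [folklore] -/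
theorem one_add_mul_div_sub_eq {t : ℝ} {z : ℂ} (htz : (t : ℂ) ≠ z) :
    (1 + t * z) / (t - z) = (1 + (t : ℂ) ^ 2) * (((t : ℂ) - z)⁻¹ - t / (1 + (t : ℂ) ^ 2)) := by
  have htz' : (t : ℂ) - z ≠ 0 := sub_ne_zero.2 htz
  have h1 : (1 + (t : ℂ) ^ 2) ≠ 0 := by
    norm_cast
    positivity
  field_simp
  ring

/-! ### Nevanlinna's representation: existence -/

/-- **Nevanlinna's representation theorem** (existence half of Rosenblum–Rovnyak 1985, App. §6,
Theorem B): a Pick function `f` has the form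
`f(z) = b + cz + π⁻¹ ∫ (1/(t - z) - t/(1 + t²)) dμ(t)` on `Π` with `b` real, `c ≥ 0` and `μ` a
positive Borel measure with `∫ dμ/(1 + t²) < ∞`. Proof: apply the Herglotz–Riesz theorem on the
disc to `G(w) = -i f(C w)`, `C(w) = i(1 + w)/(1 - w)`; the mass of the representing measure `ν`
at `ζ = 1` gives `c`, and the rest of `ν`, pushed to `ℝ` by `t = C(ζ)` and multiplied by
`π(1 + t²)`, gives `μ`, because `i(ζ + D z)/(ζ - D z) = (1 + tz)/(t - z)` for `ζ = D(t)`.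
[cite: RosenblumRovnyak1985, Appendix Section 6 Theorem B] -/
theorem IsPickFunction.exists_nevanlinna_repr {f : ℂ → ℂ} (hf : IsPickFunction f) :
    ∃ (b c : ℝ) (μ : Measure ℝ), 0 ≤ c ∧ Integrable (fun t : ℝ => (1 + t ^ 2)⁻¹) μ ∧
      ∀ z ∈ UpperHalfPlane.upperHalfPlaneSet,
        f z = (b : ℂ) + (c : ℂ) * z +
          (Real.pi : ℂ)⁻¹ * ∫ t : ℝ, (((t : ℂ) - z)⁻¹ - (t : ℂ) / (1 + (t : ℂ) ^ 2)) ∂μ := by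
  -- the disc function `G = -i f ∘ C`
  set G : ℂ → ℂ := fun w => -I * f (I * (1 + w) / (1 - w)) with hG
  have hCmem : ∀ w ∈ ball (0 : ℂ) 1, I * (1 + w) / (1 - w) ∈ UpperHalfPlane.upperHalfPlaneSet :=
    fun w hw => im_cayley_pos (by simpa using hw)
  have hGd : DifferentiableOn ℂ G (ball 0 1) := by
    refine DifferentiableOn.const_mul (hf.1.comp ?_ hCmem) (-I)
    refine DifferentiableOn.div (by fun_prop) (by fun_prop) ?_
    intro w hw h0
    have : w = 1 := by linear_combination -h0
    rw [this] at hw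
    norm_num at hw
  have hG0 : ∀ w ∈ ball (0 : ℂ) 1, 0 ≤ (G w).re := by
    intro w hw
    simpa [hG] using hf.2 _ (hCmem w hw)
  obtain ⟨ν, hνfin, hνG⟩ := exists_measure_herglotz_riesz hGd hG0
  -- the exceptional point `ζ = 1`, the Cayley parameter `t = C(ζ)` and the measure `μ`
  set one : sphere (0 : ℂ) 1 := ⟨1, by simp⟩ with hone
  set S : Set (sphere (0 : ℂ) 1) := {ζ | (ζ : ℂ) ≠ 1} with hS
  have hS_meas : MeasurableSet S :=
    (isClosed_eq continuous_subtype_val continuous_const).isOpen_compl.measurableSet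
  have hScompl : Sᶜ = {one} := by
    ext ζ
    simp only [hS, mem_compl_iff, mem_setOf_eq, not_not, mem_singleton_iff, hone]
    constructor
    · intro h; exact Subtype.ext h
    · intro h; rw [h]
  set T : sphere (0 : ℂ) 1 → ℝ := fun ζ => (I * (1 + (ζ : ℂ)) / (1 - ζ)).re with hT
  have hT_cont : ContinuousOn T {one}ᶜ := by
    rw [← hScompl, compl_compl]
    refine continuous_re.comp_continuousOn (ContinuousOn.div (by fun_prop) (by fun_prop) ?_)
    intro ζ hζ
    exact sub_ne_zero.2 (Ne.symm hζ)
  have hT_meas : Measurable T := measurable_of_continuousOn_compl_singleton one hT_cont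
  set dens : ℝ → NNReal := fun t => ⟨1 + t ^ 2, by positivity⟩ with hdens
  have hdens_meas : Measurable dens := by
    refine Measurable.subtype_mk ?_
    fun_prop
  have hdens_coe : ∀ t, ((dens t : NNReal) : ℝ) = 1 + t ^ 2 := fun t => rfl
  set μ₀ : Measure ℝ := Measure.map T (ν.restrict S) with hμ₀
  haveI : IsFiniteMeasure μ₀ := by
    rw [hμ₀]
    infer_instance
  set μ : Measure ℝ := (ENNReal.ofReal Real.pi) • μ₀.withDensity (fun t => (dens t : ENNReal))
    with hμ
  refine ⟨(f I).re, ν.real {one}, μ, measureReal_nonneg, ?_, ?_⟩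
  · -- `∫ dμ/(1+t²) = π ν(S) < ∞`
    rw [hμ]
    refine Integrable.smul_measure ?_ ENNReal.ofReal_ne_top
    rw [integrable_withDensity_iff_integrable_coe_smul hdens_meas]
    have : (fun t : ℝ => ((dens t : NNReal) : ℝ) • (1 + t ^ 2)⁻¹) = fun _ => (1 : ℝ) := by
      funext t
      rw [hdens_coe, smul_eq_mul, mul_inv_cancel₀]
      positivity
    rw [this]
    exact integrable_const 1
  · intro z hz
    have hz' : 0 < z.im := hz
    have hzI : z + I ≠ 0 := add_I_ne_zero_of_im_nonneg hz'.le
    -- `w = D z`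
    set w : ℂ := (z - I) / (z + I) with hw
    have hw_mem : w ∈ ball (0 : ℂ) 1 := by
      simpa [hw] using norm_cayleyInv_lt_one hz'
    have hCw : I * (1 + w) / (1 - w) = z := cayley_cayleyInv hzI
    -- `f z = i G(w)` and the disc representation
    have hfz : f z = I * G w := by
      simp only [hG, hCw]
      rw [← mul_assoc, mul_neg, I_mul_I, neg_neg, one_mul]
    have hG0val : (G 0).im = -(f I).re := by
      simp [hG]
    have hrepr := hνG w hw_mem
    -- splitting off the atom at `ζ = 1`
    have hk_cont : Continuous fun ζ : sphere (0 : ℂ) 1 => ((ζ : ℂ) + w) / ((ζ : ℂ) - w) :=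
      continuous_restrict_herglotz_kernel hw_mem
    have hk_int : Integrable (fun ζ : sphere (0 : ℂ) 1 => ((ζ : ℂ) + w) / ((ζ : ℂ) - w)) ν :=
      hk_cont.integrable_of_hasCompactSupport (HasCompactSupport.of_compactSpace _)
    have hsplit := integral_add_compl hS_meas hk_int
    rw [hScompl, integral_singleton] at hsplit
    -- the atom: `i (1 + w)/(1 - w) = z`
    have hatom : I * (((one : ℂ) + w) / ((one : ℂ) - w)) = z := by
      rw [← hCw, hone, mul_div_assoc]
    -- the rest: change of variables `t = T ζ`
    have hTreal : ∀ ζ : sphere (0 : ℂ) 1, (I * (1 + (ζ : ℂ)) / (1 - ζ)) = (T ζ : ℂ) := by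
      intro ζ
      apply Complex.ext
      · simp [hT]
      · rw [ofReal_im]
        exact cayley_im_eq_zero (mem_sphere_zero_iff_norm.mp ζ.2)
    have hkernel : ∀ ζ ∈ S, ((ζ : ℂ) + w) / ((ζ : ℂ) - w) =
        -I * ((1 + (T ζ) * z) / ((T ζ) - z)) := by
      intro ζ hζ
      have htz : ((T ζ : ℝ) : ℂ) ≠ z := by
        intro h
        have := congrArg Complex.im h
        rw [ofReal_im] at this
        linarith
      have hζD : (ζ : ℂ) = ((T ζ : ℂ) - I) / ((T ζ : ℂ) + I) := by
        rw [← hTreal ζ]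
        exact (cayleyInv_cayley hζ).symm
      rw [← I_mul_herglotz_kernel_cayleyInv hzI htz, ← hζD, hw, ← mul_assoc, neg_mul, I_mul_I,
        neg_neg, one_mul]
    have hrest : ∫ ζ in S, ((ζ : ℂ) + w) / ((ζ : ℂ) - w) ∂ν =
        ∫ t, -I * ((1 + t * z) / (t - z)) ∂μ₀ := by
      rw [setIntegral_congr_fun hS_meas hkernel, hμ₀, integral_map hT_meas.aemeasurable]
      refine Continuous.aestronglyMeasurable ?_
      refine continuous_const.mul (Continuous.div (by fun_prop) (by fun_prop) ?_)
      intro t h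
      have := congrArg Complex.im h
      simp at this
      linarith
    -- the integral against `μ`
    have hKμ : (Real.pi : ℂ)⁻¹ * ∫ t : ℝ, (((t : ℂ) - z)⁻¹ - (t : ℂ) / (1 + (t : ℂ) ^ 2)) ∂μ =
        ∫ t, (1 + t * z) / (t - z) ∂μ₀ := by
      rw [hμ, integral_smul_measure, ENNReal.toReal_ofReal Real.pi_pos.le,
        integral_withDensity_eq_integral_smul hdens_meas]
      have h1 : (fun t : ℝ => dens t • (((t : ℂ) - z)⁻¹ - (t : ℂ) / (1 + (t : ℂ) ^ 2))) =
          fun t : ℝ => (1 + t * z) / (t - z) := by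
        funext t
        have htz : (t : ℂ) ≠ z := by
          intro h
          have := congrArg Complex.im h
          simp at this
          linarith
        rw [one_add_mul_div_sub_eq htz, NNReal.smul_def, hdens_coe, Complex.real_smul]
        push_cast
        rfl
      rw [h1, Complex.real_smul, ← mul_assoc, inv_mul_cancel₀ (ofReal_ne_zero.2 Real.pi_ne_zero),
        one_mul]
    -- assembling
    set X : ℂ := ∫ t, (1 + t * z) / (t - z) ∂μ₀ with hX
    have hrest' : ∫ ζ in S, ((ζ : ℂ) + w) / ((ζ : ℂ) - w) ∂ν = -I * X := by
      rw [hrest, integral_const_mul]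
    rw [hKμ, hfz, hrepr, ← hsplit, hrest', hG0val, Complex.real_smul, ofReal_neg]
    linear_combination (ν.real {one} : ℂ) * hatom + (-((f I).re : ℂ) - X) * I_mul_I

end Literature.Analysis.Complex

end
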